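import Summits.QuantumFields.BalabanUV.Beta.NVertexLamK1Prime
import Summits.QuantumFields.BalabanUV.Beta.NVertexLamCorePeriodised

/-!
# `BalabanUV.Beta.NVertexLamMultColTorus` — binder row D1 ∕ (C1), PART 29: **ROAD FP's (J-ΛS) ON THE TORUS, EVERY DEPTH — THE DIAGONAL PERIODISATION OF THE N-VERTEX's Λ SECTOR
# IS THE CHART's TORUS MULTIPLIER COLUMN AGAINST THE PERIODISED COMPOSITE CONSTRAINT HESSIANS, SUMMED OVER THE COARSE TORUS**:
# `dper T (ℒN μ y)|_{(γ,a),(γ′,a′)} = Σ_ν Σ_{r ∈ pbox M} Ŝ(ν,r) · dper T (compH R.r Lc (j+1) ν r) γ γ′ (inl a) (inl a′)`,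
# `Ŝ(ν,r) := perF T (AN R j) (wrapPt T (L•r), inr ν) (wrapPt T (L•y), inr μ)` (`T i = L·M i`, `L = Lc^(j+1)`) — PART 28's (K1′)∕`ℤ⁴` form of (J-ΛS) fed through an2 g68's
# weighted-core periodisation engine (PART 16 `NVertexLamCorePeriodised` §1–§2), re-run for bricks supported in a `winF` WINDOW (the composite constraint Hessian's
# `winF (L^m) (wid L m)`, F6a `compVHKer_eq_zero_left`) instead of an1's one-step `Near` box

WHY (journal [AN2-G70-INTENT-4] PART 28; road FP g46 PART 3b v1.2 `TowerHN2RowMixedWard` (J-ΛS) `hΛS : Λ₁ (r•e_a) = cΛS • Σ_β Ŝ_a β • Ĉ_β`, `Ĉ_β := (perF T (dper T ((tabsComp (n+2) …).H β.2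
↑β.1)))|ff`, `Ŝ_a β := perF T (AN …) (wrapPt T (L•↑β.1), inr β.2) (wrapPt T (L•y_a), inr μ_a)`).  PART 28 gave (J-ΛS) on `ℤ⁴`: `ℒN μ y = Σ_ν Σ'_w (AN R j) (L•w) (L•y) (inr ν) (inr μ) ·
compH ν w`.  The road's rows live on the tower torus after `perF T ∘ dper T`; this file carries the `ℤ⁴` identity there: `dper T` of the weighted core folds the weight over the
coarse period copies (`Σ'_m AN (L•(r + M∘m)) (L•y) = perF T (AN) (wrapPt T (L•r), ·) (wrapPt T (L•y), ·)` by the chart's period invariance) and the table onto `dper T (compH ν r)`,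
`r ∈ pbox M` — the road's `Ŝ • Ĉ` letters entry by entry.  What then remains of (J-ΛS) is the identification of v5's `Λ₁ (r•e_a)` with `r·cΛ·(perF T (dper T ℒN_a))|ff` (the
H-side first-order row's bookkeeping, `TowerHN1Row` ∕ (J-X)) and the scalar `cΛS = r·Pn.cΛ (n+2)` — pins, not content.

WHAT (`d = 3` at the record, generic `d` in §1; [folklore] `tsum` re-indexing BY NAME; no `def`, no `def … : Prop`, nothing cited, 0 sorry):
* §1 PART 16's engine for WINDOW-supported bricks (`h𝓋w : g.2 ∉ winF L W y → 𝓋 i μ y g g′ = 0`; F6a″ `mem_piFinset_of_mem_winF` replaces `slot_mem_nearBox_of_near`; the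
  covariance-only letters `weightedCore_translate ∕ tsum_brick_translate_eq_dper ∕ periodisedWeight_translate` are PART 16's, reused BY NAME): `weightedCore_translate_eq_sum_winF` (generic);
  the two folding steps (`dper_weightedCore_apply ∕ _reps`, window form) are run INSIDE §3's proof at the record (their generic conclusions coincide with PART 16's — no restatement).
* §2 the record's letters: `compH_window` (F6a `compVHKer_eq_zero_left` through `compH_inl_inl_eq_compVHKer`), `compH_sh` (`compH_hHt` entrywise), `summable_AN_inr_inr` (the chart's
  `mm` row is summable along the coarse lattice — `decays_AN`, lit `summable_of_exp_bound`, injectivity of `w ↦ L•w`).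
* §3 **`dper_LN_eq_sum_reps`** — `dper T (ℒN μ y) γ γ′ (inl a) (inl a′) = Σ_ν Σ_{r ∈ pbox M} (Σ'_m (AN R j) (L•(r + M∘m)) (L•y) (inr ν) (inr μ)) · dper T (compH R.r Lc (j+1) ν r) γ γ′ (inl a) (inl a′)`
  (`T i = L·M i`); §4 **`tsum_AN_inr_inr_translate_eq_perF`** (the periodised weight IS the road's `Ŝ`: `= perF T (AN R j) (wrapPt T (L•r), inr ν) (wrapPt T (L•y), inr μ)`, by
  `AN_translate_invariant`, `perZ_translate_left`, `translate_wrap_quo`) and **`dper_LN_eq_sum_Shat_mul_dper_compH`** (§3 in the road's letters).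
WHAT THIS IS NOT: not the `perF T` of both sides (one more `perZ` on a finite sum — the consumer's line) nor v5's `Λ₁` pin; not (K2b) at depth ≥ 2; nothing of Bałaban's asserted,
valued or discharged; 0 estimates; 0∕4 row-D1 binders (hW, hR, D1Tel, D1Rep); ROOT M‴ p325680 ∕ P5c ∕ D6 untouched; NOT (C1), NOT (T-ID), NOT D1, NEVER «G-an2-4 closed», NOT BetaPertH,
NOT continuum, NOT Clay.

HONEST DEPENDENCY (page 1, mandatory): continuum YM on T⁴ ⇐ BetaPertH ∧ nine spine estimates (0/9 proved); BetaPertH ⇐ (D1) ∧ (D4) ∧ CAP+tail;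
G-an2-4 gates asym, D1 and NE2/3/4.  HONEST FRAMING (cell contract, verbatim): «discharging `BetaPertH` makes Bałaban's UV stability UNCONDITIONAL —
a real constructive-QFT result; it is NOT the continuum limit and NOT the Clay problem.»  ABSOLUTE RULE (cell charter, verbatim): «No internally-minted
statement may enter as a cited fact. Every hypothesis is either kernel-proved in this package or a verbatim quotation of a PUBLISHED theorem with page
reference. The manuscript(s) under audit are NOT citable for their own disputed steps — they are the thing under adjudication; programme-internal
(2001/route/tribunal) claims are never citable.»  Row D1 ∕ (C1) OWNER an2 (b2b-balaban-beta-an2) gen 70, 2026-08-28.  §1 adapted from an2 g68 PART 16 §1–§2 (same proofs,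
window letter generalised).  No existing file touched.
-/

noncomputable section

open scoped BigOperators

namespace Summit.QuantumFields.BalabanUV.Beta.NVertexLamMultColTorus

open Finset
open Literature.MathematicalPhysics.QuantumFieldTheory
open Literature.MathematicalPhysics.QuantumFieldTheory.Balaban1983to89
open Literature.MathematicalPhysics.QuantumFieldTheory.Balaban1983to89.Beta
open B12Sec2to5 (l1)
open B4TorusKernel.MultiPeriod (translate translate_apply translate_injective)
open B6Lemma24Torus (pbox mem_pbox)
open AffineAveraging (Site toSite)
open AveragingHessianKernels (Bond)
open ExpKernelCalculus (MKer Decays shiftK)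
open OneStepResolventKernel (Fib KInv)
open OneStepKernelFamily (vertexOfK)
open InterLevelTransport (SLam)
open BalabanStepJets (lamCoeffOf)
open KKTFluctuationEnergy (summable_of_exp_bound)
open Summit.QuantumFields.BalabanUV.Beta.AxialDressingRooted (one_le_of_neZero)
open Summit.QuantumFields.BalabanUV.Beta.SymAveragingHessianCounts (symLinKerAt symHessKerAt)
open Summit.QuantumFields.BalabanUV.Beta.CompositeVertexKernelRec (winF wid compVHKer compVHKer_eq_zero_left)
open Summit.QuantumFields.BalabanUV.Beta.CompositeVertexKernelLiftKernel (mem_piFinset_of_mem_winF)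
open Summit.QuantumFields.BalabanUV.Beta.CompositeOneShotJets (compH compH_hHt)
open Summit.QuantumFields.BalabanUV.Beta.CompositeOneShotJetData (Roots AN)
open Summit.QuantumFields.BalabanUV.Beta.NVertexSectors (decays_AN)
open Summit.QuantumFields.BalabanUV.Beta.NVertexSectorsPeriodised (AN_translate_invariant)
open Summit.QuantumFields.BalabanUV.Beta.NVertexLamSectorContracted (compH_inl_inl_eq_compVHKer)
open Summit.QuantumFields.BalabanUV.Beta.NVertexLamK1Prime (LN_eq_sum_AN_inr_inr_mul_compH)
open Summit.QuantumFields.BalabanUV.Beta.NVertexLamCorePeriodised (weightedCore_translate tsum_brick_translate_eq_dper periodisedWeight_translate)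
open Summit.QuantumFields.BalabanUV.Beta.FP.KernelPeriodisationFib (perF perF_apply perZ perZ_apply perZ_translate_left translate_eq_add)
open Summit.QuantumFields.BalabanUV.Beta.FP.KernelPeriodisationFibLoc (dper dper_apply)
open Summit.QuantumFields.BalabanUV.Beta.FP.KernelPeriodisationFibTrace (tsum_sites_eq_sum_tsum)
open Summit.QuantumFields.BalabanUV.Beta.FP.TorusGaugeCovariancePairing (wrapPt wrapPt_coe)
open Summit.QuantumFields.BalabanUV.Beta.FP.PeriodisedBorderTables (translate_eq_add_smul)
open Summit.QuantumFields.BalabanUV.Beta.GAN24.KernelPeriodisation (translate_wrap_quo)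

variable {d : ℕ}

/-! ## §1 PART 16's weighted-core periodisation engine for WINDOW-supported bricks -/

section Generic

variable {𝓋 : ℕ → Fin (d + 1) → Site (d + 1) → Bond (d + 1) → Bond (d + 1) → ℝ} {L W : ℕ} (Tc Tc' : Fin (d + 1) → ℕ)
  (h𝓋w : ∀ i μ y g g', g.2 ∉ winF L W y → 𝓋 i μ y g g' = 0)
  (h𝓋sh : ∀ i μ y t g g', 𝓋 i μ (y + t) (g.sh ((L : ℤ) • t)) (g'.sh ((L : ℤ) • t)) = 𝓋 i μ y g g')
include h𝓋w h𝓋sh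

/-- [folklore] PART 16's `weightedCore_translate` with the slot sum CUT DOWN to the explicit finite box of slots whose `winF L W` window contains `γ`
(F6a″ `mem_piFinset_of_mem_winF`). -/
theorem weightedCore_translate_eq_sum_winF (hL : 0 < L) (hT : ∀ i, Tc i = L * Tc' i) (c : ℝ) (D : Fin (d + 1) → Site (d + 1) → ℝ) (k : ℕ)
    (m γ γ' : Site (d + 1)) (a a' : Fin (d + 1)) :
    (c * ∑ κ : Fin (d + 1), ∑' s : Site (d + 1), D κ s * 𝓋 k κ s (a, translate Tc γ m) (a', translate Tc γ' m))
      = c * ∑ κ : Fin (d + 1), ∑ s ∈ Fintype.piFinset (fun i => Finset.Icc ((γ i - (W : ℤ)) / (L : ℤ)) (γ i / (L : ℤ))),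
          D κ (translate Tc' s m) * 𝓋 k κ s (a, γ) (a', γ') := by
  rw [weightedCore_translate Tc Tc' h𝓋sh hT c D k m γ γ' a a']
  congr 1
  refine Finset.sum_congr rfl fun κ _ => ?_
  exact tsum_eq_sum fun s hs => by rw [h𝓋w k κ s (a, γ) (a', γ') (fun h => hs (mem_piFinset_of_mem_winF hL h)), mul_zero]

end Generic

/-! ## §2 The record's letters: the composite constraint Hessian's window and covariance; the chart's multiplier row is summable -/

section Record

variable {Lc : ℕ} [NeZero Lc] (R : Roots Lc) (j : ℕ)

omit [NeZero Lc] in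
/-- [folklore] WINDOW: the composite constraint Hessian at depth `j+1` vanishes unless its LEFT fluctuation leg lies in `winF (Lc^(j+1)) (wid Lc (j+1)) w` (F6a `compVHKer_eq_zero_left`). -/
theorem compH_window (k : ℕ) (ν : Fin (3 + 1)) (w : Site (3 + 1)) (g g' : Bond (3 + 1)) (h : g.2 ∉ winF (Lc ^ (j + 1)) (wid Lc (j + 1)) w) :
    (fun (_ : ℕ) (ν : Fin (3 + 1)) (w : Site (3 + 1)) (g g' : Bond (3 + 1)) => compH R.r Lc (j + 1) ν w g.2 g'.2 (Sum.inl g.1) (Sum.inl g'.1)) k ν w g g' = 0 := by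
  show compH R.r Lc (j + 1) ν w g.2 g'.2 (Sum.inl g.1) (Sum.inl g'.1) = 0
  rw [compH_inl_inl_eq_compVHKer]
  exact compVHKer_eq_zero_left (j + 1) (f := (g.1, g.2)) _ h

omit [NeZero Lc] in
/-- [folklore] COVARIANCE: `compH ν (w + t) (x + L•t) (x′ + L•t) = compH ν w x x′` on every block (`compH_hHt`, `L = Lc^(j+1)`). -/
theorem compH_sh (k : ℕ) (ν : Fin (3 + 1)) (w t : Site (3 + 1)) (g g' : Bond (3 + 1)) :
    (fun (_ : ℕ) (ν : Fin (3 + 1)) (w : Site (3 + 1)) (g g' : Bond (3 + 1)) => compH R.r Lc (j + 1) ν w g.2 g'.2 (Sum.inl g.1) (Sum.inl g'.1)) k ν (w + t)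
        (g.sh (((Lc ^ (j + 1) : ℕ) : ℤ) • t)) (g'.sh (((Lc ^ (j + 1) : ℕ) : ℤ) • t))
      = (fun (_ : ℕ) (ν : Fin (3 + 1)) (w : Site (3 + 1)) (g g' : Bond (3 + 1)) => compH R.r Lc (j + 1) ν w g.2 g'.2 (Sum.inl g.1) (Sum.inl g'.1)) k ν w g g' := by
  show compH R.r Lc (j + 1) ν (w + t) (g.2 + ((Lc ^ (j + 1) : ℕ) : ℤ) • t) (g'.2 + ((Lc ^ (j + 1) : ℕ) : ℤ) • t) (Sum.inl g.1) (Sum.inl g'.1)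
      = compH R.r Lc (j + 1) ν w g.2 g'.2 (Sum.inl g.1) (Sum.inl g'.1)
  rw [compH_hHt (r := R.r) (L := Lc) (j + 1) ν w t]
  simp only [shiftK, add_neg_cancel_right]

/-- [folklore] **the chart's multiplier–multiplier row is summable along the coarse lattice**: `w ↦ (AN R j) (L•w) (L•y) (inr ν) (inr μ)` is summable (`decays_AN`, lit
`summable_of_exp_bound`, injectivity of `w ↦ L•w`). -/
theorem summable_AN_inr_inr (ν μ : Fin (3 + 1)) (y : Site (3 + 1)) :
    Summable fun w : Site (3 + 1) => AN R j (((Lc ^ (j + 1) : ℕ) : ℤ) • w) (((Lc ^ (j + 1) : ℕ) : ℤ) • y) (Sum.inr ν) (Sum.inr μ) := by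
  obtain ⟨δ, C, hδ, -, hK⟩ := decays_AN R j
  have hfull : Summable fun x : Site (3 + 1) => AN R j x (((Lc ^ (j + 1) : ℕ) : ℤ) • y) (Sum.inr ν) (Sum.inr μ) :=
    summable_of_exp_bound hδ _ fun x => hK x _ _ _
  have hL : (((Lc ^ (j + 1) : ℕ) : ℤ)) ≠ 0 := by exact_mod_cast NeZero.ne (Lc ^ (j + 1))
  exact hfull.comp_injective (smul_right_injective (Site (3 + 1)) hL)

/-! ## §3 The diagonal periodisation of the Λ sector: periodised multiplier row times periodised constraint Hessian, summed over the coarse torus -/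

variable (T M : Fin (3 + 1) → ℕ) [∀ i, NeZero (M i)]

/-- [folklore] **`dper_LN_eq_sum_reps` — THE Λ SECTOR, DIAGONALLY PERIODISED** (`T i = L·M i`, `L = Lc^(j+1)`; every source `(μ, y)`, every `ff` entry):
`dper T (ℒN μ y) γ γ′ (inl a) (inl a′) = Σ_ν Σ_{r ∈ pbox M} (Σ'_m (AN R j) (L•(r + M∘m)) (L•y) (inr ν) (inr μ)) · dper T (compH R.r Lc (j+1) ν r) γ γ′ (inl a) (inl a′)`
— PART 28's `ℒN = Σ_ν Σ'_w (AN)_{mm}(w) · compH ν w` through §1's engine at the composite constraint Hessian's window. -/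
theorem dper_LN_eq_sum_reps (hT : ∀ i, T i = Lc ^ (j + 1) * M i) (μ : Fin (3 + 1)) (y γ γ' : Site (3 + 1)) (a a' : Fin (3 + 1)) :
    dper T (vertexOfK (AN R j) (Lc ^ (j + 1))
        (SLam (Lc ^ (j + 1)) (lamCoeffOf (KInv (N := Lc ^ (j + 1)) (d := 3)) (Lc ^ (j + 1))) (compH R.r Lc (j + 1))) μ y) γ γ' (Sum.inl a) (Sum.inl a')
      = ∑ ν : Fin (3 + 1), ∑ r : ↥(pbox M),
          (∑' m : Site (3 + 1), AN R j (((Lc ^ (j + 1) : ℕ) : ℤ) • translate M (r : Site (3 + 1)) m) (((Lc ^ (j + 1) : ℕ) : ℤ) • y) (Sum.inr ν) (Sum.inr μ))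
            * dper T (compH R.r Lc (j + 1) ν (r : Site (3 + 1))) γ γ' (Sum.inl a) (Sum.inl a') := by
  have hL : 0 < Lc ^ (j + 1) := Nat.pos_of_ne_zero (NeZero.ne _)
  have hM1 : ∀ i, 1 ≤ M i := fun i => one_le_of_neZero (M i)
  -- the brick family (the composite constraint Hessian's `ff` block) and the weight (the chart's `mm` row), in PART 16's engine shape
  set V : ℕ → Fin (3 + 1) → Site (3 + 1) → Bond (3 + 1) → Bond (3 + 1) → ℝ :=
    fun _ ν w g g' => compH R.r Lc (j + 1) ν w g.2 g'.2 (Sum.inl g.1) (Sum.inl g'.1) with hV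
  set D : Fin (3 + 1) → Site (3 + 1) → ℝ :=
    fun ν w => AN R j (((Lc ^ (j + 1) : ℕ) : ℤ) • w) (((Lc ^ (j + 1) : ℕ) : ℤ) • y) (Sum.inr ν) (Sum.inr μ) with hD
  have hVw : ∀ i ν w g g', g.2 ∉ winF (Lc ^ (j + 1)) (wid Lc (j + 1)) w → V i ν w g g' = 0 := fun i ν w g g' h => compH_window R j i ν w g g' h
  have hVsh : ∀ i ν w t g g', V i ν (w + t) (g.sh (((Lc ^ (j + 1) : ℕ) : ℤ) • t)) (g'.sh (((Lc ^ (j + 1) : ℕ) : ℤ) • t)) = V i ν w g g' :=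
    fun i ν w t g g' => compH_sh R j i ν w t g g'
  have hDs : ∀ ν, Summable (D ν) := fun ν => summable_AN_inr_inr R j ν μ y
  have hDm : ∀ (ν : Fin (3 + 1)) (s : Site (3 + 1)), Summable fun m : Site (3 + 1) => D ν (translate M s m) :=
    fun ν s => (hDs ν).comp_injective (translate_injective hM1 s)
  set NB := Fintype.piFinset (fun i => Finset.Icc ((γ i - (wid Lc (j + 1) : ℤ)) / ((Lc ^ (j + 1) : ℕ) : ℤ)) (γ i / ((Lc ^ (j + 1) : ℕ) : ℤ))) with hNB
  -- the Λ sector IS the weighted core (PART 28), so its diagonal periodisation is the core's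
  have lhs : dper T (vertexOfK (AN R j) (Lc ^ (j + 1))
        (SLam (Lc ^ (j + 1)) (lamCoeffOf (KInv (N := Lc ^ (j + 1)) (d := 3)) (Lc ^ (j + 1))) (compH R.r Lc (j + 1))) μ y) γ γ' (Sum.inl a) (Sum.inl a')
      = ∑' m : Site (3 + 1), (1 : ℝ) * ∑ ν : Fin (3 + 1), ∑' w : Site (3 + 1), D ν w * V 0 ν w (a, translate T γ m) (a', translate T γ' m) := by
    simp only [dper_apply, LN_eq_sum_AN_inr_inr_mul_compH, one_mul, hV, hD]
  -- step 1 (PART 16 `dper_weightedCore_apply`, window form): the diagonal periodisation is the core with PERIODISED weight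
  have step1 : (∑' m : Site (3 + 1), (1 : ℝ) * ∑ ν : Fin (3 + 1), ∑' w : Site (3 + 1), D ν w * V 0 ν w (a, translate T γ m) (a', translate T γ' m))
      = ∑ ν : Fin (3 + 1), ∑' s : Site (3 + 1), (∑' m : Site (3 + 1), D ν (translate M s m)) * V 0 ν s (a, γ) (a', γ') := by
    have hpt : ∀ m : Site (3 + 1),
        ((1 : ℝ) * ∑ ν : Fin (3 + 1), ∑' w : Site (3 + 1), D ν w * V 0 ν w (a, translate T γ m) (a', translate T γ' m))
          = 1 * ∑ ν : Fin (3 + 1), ∑ s ∈ NB, D ν (translate M s m) * V 0 ν s (a, γ) (a', γ') :=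
      fun m => weightedCore_translate_eq_sum_winF T M hVw hVsh hL hT 1 D 0 m γ γ' a a'
    simp_rw [hpt, one_mul]
    rw [Summable.tsum_finsetSum fun ν _ => summable_sum fun s _ => (hDm ν s).mul_right _]
    refine Finset.sum_congr rfl fun ν _ => ?_
    rw [Summable.tsum_finsetSum fun s _ => (hDm ν s).mul_right _,
      tsum_eq_sum (s := NB) fun s hs => by rw [hVw 0 ν s (a, γ) (a', γ') (fun h => hs (mem_piFinset_of_mem_winF hL h)), mul_zero]]
    exact Finset.sum_congr rfl fun s _ => tsum_mul_right
  -- step 2 (PART 16 `dper_weightedCore_apply_reps`): the periodised weight is `M`-periodic, the slot sum folds onto `pbox M`, the brick's translates sum to its `dper`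
  have step2 : ∀ ν : Fin (3 + 1), (∑' s : Site (3 + 1), (∑' m : Site (3 + 1), D ν (translate M s m)) * V 0 ν s (a, γ) (a', γ'))
      = ∑ r : ↥(pbox M), (∑' m : Site (3 + 1), D ν (translate M (r : Site (3 + 1)) m))
          * dper T (fun x x' (b b' : Fin (3 + 1)) => V 0 ν (r : Site (3 + 1)) (b, x) (b', x')) γ γ' a a' := fun ν => by
    have hG : Summable fun s : Site (3 + 1) => (∑' m : Site (3 + 1), D ν (translate M s m)) * V 0 ν s (a, γ) (a', γ') :=
      summable_of_ne_finset_zero (s := NB) fun s hs => by rw [hVw 0 ν s (a, γ) (a', γ') (fun h => hs (mem_piFinset_of_mem_winF hL h)), mul_zero]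
    rw [tsum_sites_eq_sum_tsum (M := M) hG]
    refine Finset.sum_congr rfl fun r _ => ?_
    simp_rw [periodisedWeight_translate M (D ν)]
    rw [tsum_mul_left, tsum_brick_translate_eq_dper T M hVsh hT 0 ν (r : Site (3 + 1)) γ γ' a a']
  rw [lhs, step1]
  refine Finset.sum_congr rfl fun ν _ => ?_
  rw [step2 ν]
  refine Finset.sum_congr rfl fun r _ => ?_
  simp only [hD, hV, dper_apply]

/-! ## §4 The periodised weight is the road's torus multiplier column `Ŝ` -/

omit [∀ i, NeZero (M i)] in
/-- [folklore] **`tsum_AN_inr_inr_translate_eq_perF` — THE PERIODISED MULTIPLIER ROW IS THE CHART's TORUS ENTRY** (`T i = L·M i`): `Σ'_m (AN R j) (L•(r + M∘m)) (L•y) (inr ν) (inr μ)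
= perF T (AN R j) (wrapPt T (L•r), inr ν) (wrapPt T (L•y), inr μ)` (the chart's period invariance `AN_translate_invariant`, `perZ_translate_left`, `translate_wrap_quo`). -/
theorem tsum_AN_inr_inr_translate_eq_perF [∀ i, NeZero (T i)] (hT : ∀ i, T i = Lc ^ (j + 1) * M i) (r y : Site (3 + 1)) (ν μ : Fin (3 + 1)) :
    (∑' m : Site (3 + 1), AN R j (((Lc ^ (j + 1) : ℕ) : ℤ) • translate M r m) (((Lc ^ (j + 1) : ℕ) : ℤ) • y) (Sum.inr ν) (Sum.inr μ))
      = perF T (AN R j) (wrapPt T (((Lc ^ (j + 1) : ℕ) : ℤ) • r), Sum.inr ν) (wrapPt T (((Lc ^ (j + 1) : ℕ) : ℤ) • y), Sum.inr μ) := by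
  have hdvd : ∀ i, Lc ^ (j + 1) ∣ T i := fun i => ⟨M i, hT i⟩
  have hinv := AN_translate_invariant R j (M := T) hdvd
  -- each copy: `L•(r + M∘m) = (L•r) + T∘m`, then move the translate onto the source index by the chart's period invariance
  have hcopy : ∀ m : Site (3 + 1), AN R j (((Lc ^ (j + 1) : ℕ) : ℤ) • translate M r m) (((Lc ^ (j + 1) : ℕ) : ℤ) • y) (Sum.inr ν) (Sum.inr μ)
      = AN R j (((Lc ^ (j + 1) : ℕ) : ℤ) • r) (translate T (((Lc ^ (j + 1) : ℕ) : ℤ) • y) (-m)) (Sum.inr ν) (Sum.inr μ) := fun m => by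
    have e1 : ((Lc ^ (j + 1) : ℕ) : ℤ) • translate M r m = translate T (((Lc ^ (j + 1) : ℕ) : ℤ) • r) m := by
      rw [translate_eq_add_smul hT, translate_eq_add, smul_add]
    have e2 : translate T (translate T (((Lc ^ (j + 1) : ℕ) : ℤ) • y) (-m)) m = ((Lc ^ (j + 1) : ℕ) : ℤ) • y := by
      rw [B4Reflection242.translate_translate, neg_add_cancel]
      funext i
      rw [translate_apply, Pi.zero_apply, mul_zero, add_zero]
    rw [e1]
    conv_lhs => rw [← e2]
    rw [hinv]
  have hneg := (Equiv.neg (Site (3 + 1))).tsum_eq fun m => AN R j (((Lc ^ (j + 1) : ℕ) : ℤ) • r) (translate T (((Lc ^ (j + 1) : ℕ) : ℤ) • y) m) (Sum.inr ν) (Sum.inr μ)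
  simp only [Equiv.neg_apply] at hneg
  rw [tsum_congr hcopy, hneg, ← perZ_apply]
  simp only [perF_apply, wrapPt_coe]
  conv_lhs => rw [← translate_wrap_quo T (((Lc ^ (j + 1) : ℕ) : ℤ) • r), ← translate_wrap_quo T (((Lc ^ (j + 1) : ℕ) : ℤ) • y)]
  rw [perZ_translate_left T hinv, FP.KernelPeriodisationFib.perZ_translate_right]

/-- [folklore] **`dper_LN_eq_sum_Shat_mul_dper_compH` — (J-ΛS) AFTER THE DIAGONAL PERIODISATION, IN ROAD FP's LETTERS** (`T i = L·M i`): for every source `(μ, y)` and `ff` entry,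
`dper T (ℒN μ y) γ γ′ (inl a) (inl a′) = Σ_ν Σ_{r ∈ pbox M} perF T (AN R j) (wrapPt T (L•r), inr ν) (wrapPt T (L•y), inr μ) · dper T (compH R.r Lc (j+1) ν r) γ γ′ (inl a) (inl a′)`
— the chart's torus MULTIPLIER COLUMN `Ŝ` against the diagonally periodised composite constraint Hessians, summed over the coarse torus bonds `(r, ν)`; one more `perZ` in `γ′` on both
sides (a finite sum) gives the road's `Σ_β Ŝ_a β • Ĉ_β` with `Ĉ_β = (perF T (dper T (compH … β.2 ↑β.1)))|ff`. -/
theorem dper_LN_eq_sum_Shat_mul_dper_compH [∀ i, NeZero (T i)] (hT : ∀ i, T i = Lc ^ (j + 1) * M i) (μ : Fin (3 + 1)) (y γ γ' : Site (3 + 1)) (a a' : Fin (3 + 1)) :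
    dper T (vertexOfK (AN R j) (Lc ^ (j + 1))
        (SLam (Lc ^ (j + 1)) (lamCoeffOf (KInv (N := Lc ^ (j + 1)) (d := 3)) (Lc ^ (j + 1))) (compH R.r Lc (j + 1))) μ y) γ γ' (Sum.inl a) (Sum.inl a')
      = ∑ ν : Fin (3 + 1), ∑ r : ↥(pbox M),
          perF T (AN R j) (wrapPt T (((Lc ^ (j + 1) : ℕ) : ℤ) • (r : Site (3 + 1))), Sum.inr ν) (wrapPt T (((Lc ^ (j + 1) : ℕ) : ℤ) • y), Sum.inr μ)
            * dper T (compH R.r Lc (j + 1) ν (r : Site (3 + 1))) γ γ' (Sum.inl a) (Sum.inl a') := by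
  rw [dper_LN_eq_sum_reps R j T M hT μ y γ γ' a a']
  refine Finset.sum_congr rfl fun ν _ => Finset.sum_congr rfl fun r _ => ?_
  rw [tsum_AN_inr_inr_translate_eq_perF R j T M hT]

end Record

end Summit.QuantumFields.BalabanUV.Beta.NVertexLamMultColTorus

end
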